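import Literature.MathematicalPhysics.QuantumFieldTheory.Balaban1983to89.B15Prop1WindowDirectPackageFromLetters

/-!
# `Balaban1983to89.B15Prop1WindowGaugeLetterOfGaugeLetterLoc` — [Balaban1989LargeFieldII] p. 357 ∕ [Balaban1985Variational] (4) p. 278, (16)–(18) p. 280 ∕ [Balaban1988Convergent] (2.2),
# (2.12): THE WINDOW GAUGE LETTER (σ)_W OF THE DIRECT ROAD FROM THE LOCALISED GAUGE LETTER (σ)_N OF THE ROAD OF RECORD — a pure restriction (bookkeeping), so that the direct
# road's knit is dischargeable TODAY on every instance the road of record serves; the window-local producer for general `Z` replaces this one file later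

Honest framing: statement-level bookkeeping with citation tags; nothing here is a claim about the Yang–Mills mass gap.

Cell `pub-ymgap`, HUMAN RULINGS D-0062 ∕ D-0149, lane owner `pub-ymgap-dag-n12-c` (g20) on node N12 = [B15]; count-neutral helper of K1⁹ `stmt-QuantumFields-27364`.  The (WD) package
producer `B15Prop1WindowDirectPackageFromLetters.hWD_of_windowLetters_on` (p658881) displays the window gauge letter (σ)_W: a residual gauge `σ` of the (2.12) minimiser (root
letter `hu`) with `σ • U₀` bond-wise near `1` on the plaquette bonds of a finite window `W i` and on the feeds of the window box's level-`k` plaquette bonds.  The road of record's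
localised gauge letter (σ)_N (dag-n12-w3's capstone `…N12GaugeLetterLocAtRecord` ∕ `…Explicit(Local)`, dag-n12-w6's box producer; shape of `B15Prop1NearFlatPackageFromLettersLoc`'s
`hσ`) delivers MORE wherever it is inhabitable: `hu` + near-flatness on the four bonds of EVERY `Ω₁(Z)`-touching plaquette (`δc i`) + on `inputs 𝐁_k(Z) ∩ N i` (`δin i`).  THIS FILE:
(σ)_N ⟹ (σ)_W under two geometry letters per instance — `hWΩ` (every window plaquette has a bond starting in `Ω₁(Z_i)`; the window box lies in `Ω_k(Z_i) ⊆ Ω₁(Z_i)` by `hΩw`) and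
`hfeedsN` (the window's level-`k` feeds are `inputs`-bonds of `𝐁_k(Z_i)` inside `N i`) — with `δW i := δin i`.  Consequence: on the road of record's scope (simply-connected
normalisable `Ω₁(Z_i)`: box ∕ cube-tree `Z`) the direct road's (σ)_W is inhabited BY NAME today; for general `Z` the window-local producer (lane successor ∕ dag-n12-w3) replaces
this file and nothing downstream changes.

WHAT THIS FILE PROVES (no `sorry`, no definition; axioms standard).
★★ `hσW_of_gaugeLetterN_on` — family form: (σ)_N (p636506's `hσ` shape) + `hWΩ` + `hfeedsN` ⟹ (σ)_W (p658881's `hσW` shape) with `δW := δin`.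

HONEST SCOPE.  Quantifier bookkeeping only; inherits (σ)_N's inhabitability scope (LOCATED-GEOM v3 ∕ LOCATED-WJ apply to (σ)_N, NOT to (σ)_W itself); nothing of Bałaban's asserted;
count-neutral; NOT a discharge of N12; K1 NOT closed; one finite four-torus programme at fixed `ε = L^{-K}` — nothing continuum ∕ ℝ⁴ ∕ OS ∕ mass-gap ∕ Clay.
-/

noncomputable section

open Set Finset Metric Filter
open scoped BigOperators Matrix RealInnerProductSpace Real InnerProductSpace Topology Matrix.Norms.L2Operator

namespace Literature.MathematicalPhysics.QuantumFieldTheory.Balaban1983to89.B15Prop1WindowGaugeLetterOfGaugeLetterLoc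

open B15DeterminingSets GaugeField B16Sect1Backgrounds B15Prop1Carrier B8Eq17ClassAkV1 BlockAveraging
open B15Prop1ChartCalculusSU2 (E3)
open T4CubeChartGnomonic (SU2)
open B15Prop1ChartSU2 (su2Chart)
open B15Prop1SliceCoordinates (GaugeSlice ιA freeBonds)
open T4AdjointCovarianceUnitary (lieSU)
open T4AxialGaugeSmallField (castSite boxPlaqs boxBonds)
open B16Eq18Proof (box mem_box)
open B14.Eq213DetSet B14.Eq216Concrete B15Sect1Instances B16Sect1Wilson
open B14.Eq22Determines (blockIter)
open Literature.MathematicalPhysics.QuantumFieldTheory.BalabanImbrieJaffe1984to88.BIJ85Eq453GaugeField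
open Node00 (expChart msChart constrCard)
open T4Continuum

variable {F : T4Family}

/-- ★★ **(σ)_N ⟹ (σ)_W**: per instance `i` and per guarded base field with `ρn i`-normalised extended datum, the road of record's localised gauge letter — a residual gauge `σ` (root
letter) with `σ • U₀` `δc i`-near `1` on the four bonds of every `Ω₁(Z_i)`-touching plaquette and `δin i`-near `1` on `inputs 𝐁_k(Z_i) ∩ N i` — gives the direct road's window gauge
letter for any window `W i` of `Ω₁(Z_i)`-touching plaquettes (`hWΩ`) whose level-`k` feeds are `inputs`-bonds inside `N i` (`hfeedsN`), with `δW i := δin i`.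
[cite: Balaban1989LargeFieldII, p.357; Balaban1985Variational, (4) p.278, (16)–(18) p.280; Balaban1988Convergent, (2.2) p.255, (2.12) p.256] -/
theorem hσW_of_gaugeLetterN_on (ν : Node00.Stage7Numerics) (Kt : ℕ) (h0 : 0 < (F.P Kt).d) {ι : Type}
    (Z Λ : ι → Set (Site (F.P Kt) 0)) (k : ι → ℕ) (eR : ι → ℝ) (lo hi : ι → Fin (F.P Kt).d → ℤ)
    (ext : ∀ i, GaugeField (F.P Kt) (k i) SU2 → GaugeField (F.P Kt) (k i) SU2)
    (LO HI : ι → Fin (F.P Kt).d → ℤ) (ρn : ι → ℝ)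
    (N : ι → Set (PBond (F.P Kt) 0)) (W : ι → Finset (Plaq (F.P Kt) 0))
    {δc δin : ι → ℝ}
    -- geometry: window plaquettes touch `Ω₁(Z_i)`; the window's level-`k` feeds are `inputs`-bonds of `𝐁_k(Z_i)` inside `N i`
    (hWΩ : ∀ i, ∀ p ∈ W i, ((⟨p.src, p.μ⟩ : PBond (F.P Kt) 0) ∈ {b : PBond (F.P Kt) 0 | b.src ∈ maxDomT ν.M₁ (Z i) 1} ∨
            (⟨p.src.shift p.μ, p.ν⟩ : PBond (F.P Kt) 0) ∈ {b : PBond (F.P Kt) 0 | b.src ∈ maxDomT ν.M₁ (Z i) 1} ∨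
            (⟨p.src.shift p.ν, p.μ⟩ : PBond (F.P Kt) 0) ∈ {b : PBond (F.P Kt) 0 | b.src ∈ maxDomT ν.M₁ (Z i) 1} ∨
            (⟨p.src, p.ν⟩ : PBond (F.P Kt) 0) ∈ {b : PBond (F.P Kt) 0 | b.src ∈ maxDomT ν.M₁ (Z i) 1}))
    (hfeedsN : ∀ i (ν' : Fin (F.P Kt).d), ∀ z ∈ box (fun κ => (hi i κ - lo i κ + 1).toNat + 3) (fun κ => lo i κ - 2), ∀ b₀ : PBond (F.P Kt) 0,
      (b₀ ∈ feeds (k i) (⟨(castSite z : Site (F.P Kt) (k i)), ⟨0, h0⟩⟩ : PBond (F.P Kt) (k i)) ∨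
              b₀ ∈ feeds (k i) (⟨((castSite z : Site (F.P Kt) (k i))).shift ⟨0, h0⟩, ν'⟩ : PBond (F.P Kt) (k i)) ∨
              b₀ ∈ feeds (k i) (⟨((castSite z : Site (F.P Kt) (k i))).shift ν', ⟨0, h0⟩⟩ : PBond (F.P Kt) (k i)) ∨
              b₀ ∈ feeds (k i) (⟨(castSite z : Site (F.P Kt) (k i)), ν'⟩ : PBond (F.P Kt) (k i))) →
      b₀ ∈ inputs (Bj ν.M₁ (Z i) (k i)) ∧ b₀ ∈ N i)
    -- (σ)_N THE LOCALISED GAUGE LETTER OF THE ROAD OF RECORD (p636506's `hσ` shape)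
    (hσ : ∀ i (Vk : GaugeField (F.P Kt) (k i) SU2), PlaqSmallOn (plaqsInside (pts (k i) (Z i ∩ (Λ i)ᶜ))) (eR i) Vk →
      (∀ b ∈ (boxBonds (LO i) (HI i) : Set (PBond (F.P Kt) (k i))), dist1 (ext i Vk b) ≤ ρn i) →
      ∀ U₀ : GaugeField (F.P Kt) 0 SU2,
        IsMinimizer (Node00.avOfRecord F 2 Kt) (Node00.regMSCoPOfRecord F 2 ν Kt (k i) (maxDomT ν.M₁ (Z i))) (Bj ν.M₁ (Z i) (k i))
          (avgFamily (Node00.avOfRecord F 2 Kt) (qsstarGIter0 (k i) (ext i Vk))) U₀ →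
        ∃ σ : GaugeTransf (F.P Kt) 0 SU2,
          (∀ j, j ≤ k i → ∀ b ∈ bondsOf (Bj ν.M₁ (Z i) (k i) j), toMS σ j b.src = 1 ∧ toMS σ j b.tgt = 1) ∧
            (∀ p : Plaq (F.P Kt) 0, ((⟨p.src, p.μ⟩ : PBond (F.P Kt) 0) ∈ {b : PBond (F.P Kt) 0 | b.src ∈ maxDomT ν.M₁ (Z i) 1} ∨
            (⟨p.src.shift p.μ, p.ν⟩ : PBond (F.P Kt) 0) ∈ {b : PBond (F.P Kt) 0 | b.src ∈ maxDomT ν.M₁ (Z i) 1} ∨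
            (⟨p.src.shift p.ν, p.μ⟩ : PBond (F.P Kt) 0) ∈ {b : PBond (F.P Kt) 0 | b.src ∈ maxDomT ν.M₁ (Z i) 1} ∨
            (⟨p.src, p.ν⟩ : PBond (F.P Kt) 0) ∈ {b : PBond (F.P Kt) 0 | b.src ∈ maxDomT ν.M₁ (Z i) 1}) →
              ‖((gaugeAct σ U₀ ⟨p.src, p.μ⟩ : SU2) : Matrix (Fin 2) (Fin 2) ℂ) - 1‖ ≤ δc i ∧ ‖((gaugeAct σ U₀ ⟨p.src.shift p.μ, p.ν⟩ : SU2) : Matrix (Fin 2) (Fin 2) ℂ) - 1‖ ≤ δc i ∧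
            ‖((gaugeAct σ U₀ ⟨p.src.shift p.ν, p.μ⟩ : SU2) : Matrix (Fin 2) (Fin 2) ℂ) - 1‖ ≤ δc i ∧ ‖((gaugeAct σ U₀ ⟨p.src, p.ν⟩ : SU2) : Matrix (Fin 2) (Fin 2) ℂ) - 1‖ ≤ δc i) ∧
          (∀ b ∈ inputs (Bj ν.M₁ (Z i) (k i)), b ∈ N i → ‖((gaugeAct σ U₀ b : SU2) : Matrix (Fin 2) (Fin 2) ℂ) - 1‖ ≤ δin i))
    : ∀ i (Vk : GaugeField (F.P Kt) (k i) SU2), PlaqSmallOn (plaqsInside (pts (k i) (Z i ∩ (Λ i)ᶜ))) (eR i) Vk →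
      (∀ b ∈ (boxBonds (LO i) (HI i) : Set (PBond (F.P Kt) (k i))), dist1 (ext i Vk b) ≤ ρn i) →
      ∀ U₀ : GaugeField (F.P Kt) 0 SU2,
        IsMinimizer (Node00.avOfRecord F 2 Kt) (Node00.regMSCoPOfRecord F 2 ν Kt (k i) (maxDomT ν.M₁ (Z i))) (Bj ν.M₁ (Z i) (k i))
          (avgFamily (Node00.avOfRecord F 2 Kt) (qsstarGIter0 (k i) (ext i Vk))) U₀ →
        ∃ σ : GaugeTransf (F.P Kt) 0 SU2,
          (∀ j, j ≤ k i → ∀ b ∈ bondsOf (Bj ν.M₁ (Z i) (k i) j), toMS σ j b.src = 1 ∧ toMS σ j b.tgt = 1) ∧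
          (∀ p ∈ W i, ‖((gaugeAct σ U₀ ⟨p.src, p.μ⟩ : SU2) : Matrix (Fin 2) (Fin 2) ℂ) - 1‖ ≤ δc i ∧ ‖((gaugeAct σ U₀ ⟨p.src.shift p.μ, p.ν⟩ : SU2) : Matrix (Fin 2) (Fin 2) ℂ) - 1‖ ≤ δc i ∧
            ‖((gaugeAct σ U₀ ⟨p.src.shift p.ν, p.μ⟩ : SU2) : Matrix (Fin 2) (Fin 2) ℂ) - 1‖ ≤ δc i ∧ ‖((gaugeAct σ U₀ ⟨p.src, p.ν⟩ : SU2) : Matrix (Fin 2) (Fin 2) ℂ) - 1‖ ≤ δc i) ∧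
          (∀ (ν' : Fin (F.P Kt).d), ∀ z ∈ box (fun κ => (hi i κ - lo i κ + 1).toNat + 3) (fun κ => lo i κ - 2), ∀ b₀ : PBond (F.P Kt) 0,
            (b₀ ∈ feeds (k i) (⟨(castSite z : Site (F.P Kt) (k i)), ⟨0, h0⟩⟩ : PBond (F.P Kt) (k i)) ∨
              b₀ ∈ feeds (k i) (⟨((castSite z : Site (F.P Kt) (k i))).shift ⟨0, h0⟩, ν'⟩ : PBond (F.P Kt) (k i)) ∨
              b₀ ∈ feeds (k i) (⟨((castSite z : Site (F.P Kt) (k i))).shift ν', ⟨0, h0⟩⟩ : PBond (F.P Kt) (k i)) ∨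
              b₀ ∈ feeds (k i) (⟨(castSite z : Site (F.P Kt) (k i)), ν'⟩ : PBond (F.P Kt) (k i))) →
            ‖((gaugeAct σ U₀ b₀ : SU2) : Matrix (Fin 2) (Fin 2) ℂ) - 1‖ ≤ δin i) := by
  intro i Vk hV hnV U₀ hmin0
  obtain ⟨σ, hu, hC1, hCinN⟩ := hσ i Vk hV hnV U₀ hmin0
  refine ⟨σ, hu, fun p hp => hC1 p (hWΩ i p hp), fun ν' z hz b₀ hb₀ => ?_⟩
  obtain ⟨hin, hN⟩ := hfeedsN i ν' z hz b₀ hb₀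
  exact hCinN b₀ hin hN

end Literature.MathematicalPhysics.QuantumFieldTheory.Balaban1983to89.B15Prop1WindowGaugeLetterOfGaugeLetterLoc

end
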